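/-
# The cyclic sibling of the quad-span reduction (soloist `solo-ValiantsHypothesis-informed`, s10)

Restricting a degree-`≤ 2` cover `im f_S ⊆ im Γ` of the design monomial map `f_S = (x^{S_i})_i`
to the CYCLIC SUBGROUP `a ↦ (ζ_d^{a D^r})_{r < n}` (`a ∈ ℤ/d`, `D = hK + 1`, `ζ_d = exp(2πi/d)`)
of the torus turns each coordinate `x^{S_i}` into the CHARACTER `a ↦ ζ_d^{e_i a}` of `ℤ/d`,
`e_i = ∑_{r ∈ S_i} D^r`, and the cover into `s` arbitrary functions `v_1, …, v_s : ℤ/d → ℂ` with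
every `χ_{e_i}` in `span_ℂ {1, v_j, v_j v_l}` (pointwise products).  For `d > K h D^n` the
residues `e_i mod d` are pairwise distinct and `(K, h)`-free IN `ℤ/d` (a relation that is
`≡ 0 (mod d)` has absolute value `< d`, hence is an integer relation, hence trivial by
`solo_free_image`).  So the purely finite statement

  (Q_cyc)  for some `K, h`, some `γ < 3/2` and `C`: for every `d ≥ 1`, all functions
           `v_1..v_s : ℤ/d → ℂ` and every `E ⊂ [0, d)` that is `(K, h)`-free modulo `d` with all
           characters `a ↦ ζ_d^{e a}` (`e ∈ E`) in `span {1, v_j, v_j v_l}`:  `|E| ≤ C s^γ`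

implies `(s, 2)`-elusiveness of the design maps and hence — through Raz 2010, result 1 or
Cor. 5.8 (tree theorems `Raz2010_result_1_holds`, `Raz2010_cor_5_8_holds`) and the Reed–Solomon
designs of `SoloInformedRSDesign` — `VP ℂ ≠ VNP ℂ`.  No symbolic lemma, no algebraic functions:
the restriction principle `solo_restrict_of_not_isElusive` of the Boolean file suffices.  At paper
level (Q_cyc) also implies the univariate (Q*) of `SoloInformedQuadSpanReduction` (evaluate the
algebraic sections on the fibres of the curve over a twisted `μ_d`), so it is the strongest and the
simplest of the three siblings (curve / cube / cyclic group).  The bound (Q_cyc) is a HYPOTHESIS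
(structure `SoloCycQuadSpanBound`); nothing here asserts it.

References: R. Raz, Elusive functions and lower bounds for arithmetic circuits, Theory of
Computing 6 (2010), Defs. 1.1, 1.3, §1 result 1, Cor. 1.14 = Cor. 5.8 [cite: Raz2010].
-/
import Mathlib
import Summits.ValiantsHypothesis.ValiantsHypothesis.Theorems.SoloInformedQuadSpanReduction
import Summits.ValiantsHypothesis.ValiantsHypothesis.Theorems.SoloInformedBooleanQuadSpan

noncomputable section

open MvPolynomial Finset

namespace Summit.ValiantsHypothesis.ValiantsHypothesis.Theorems

open Literature.Computability.AlgebraicComplexity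

/-! ### Roots of unity, characters of `ℤ/d`, the cyclic subgroup of the torus -/

/-- The standard primitive `d`-th root of unity `ζ_d = exp(2πi/d)`. -/
def soloZeta (d : ℕ) : ℂ := Complex.exp (2 * Real.pi * Complex.I / d)

/-- `ζ_d` is a primitive `d`-th root of unity (`d ≠ 0`). [folklore] -/
theorem soloZeta_isPrimitiveRoot {d : ℕ} (hd : d ≠ 0) : IsPrimitiveRoot (soloZeta d) d :=
  Complex.isPrimitiveRoot_exp d hd

/-- The character of `ℤ/d` with frequency `e`, `a ↦ ζ_d^{e a}`, as a function on `Fin d`. -/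
def soloCycChar (d e : ℕ) (a : Fin d) : ℂ := soloZeta d ^ (e * (a : ℕ))

/-- The point `(ζ_d^{a D^r})_{r < n}` of the cyclic subgroup of the torus `(ℂ^*)^n` attached to
`a ∈ ℤ/d` (`D = hK + 1` the base of `soloExp`). -/
def soloCycPoint (K h d : ℕ) {n : ℕ} (a : Fin d) : Fin n → ℂ :=
  fun r => soloZeta d ^ ((a : ℕ) * soloBase K h ^ (r : ℕ))

/-- On the cyclic subgroup the `i`-th design monomial is the character with frequency `e_i`. -/
theorem solo_eval_designMap_cyc {K h d m n : ℕ} (S : Fin m → Finset (Fin n)) (a : Fin d)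
    (i : Fin m) :
    eval (soloCycPoint K h d a) (soloDesignMap S i) = soloCycChar d (soloExp K h S i) a := by
  simp only [soloDesignMap, soloCycPoint, soloCycChar, soloExp, map_prod, eval_X,
    Finset.prod_pow_eq_pow_sum, Finset.sum_mul]
  congr 1
  exact Finset.sum_congr rfl fun r _ => Nat.mul_comm _ _

/-- `D = hK + 1 ≥ 2` for `K ≥ 2`, `h ≥ 1`. -/
theorem solo_two_le_base {K h : ℕ} (hK : 2 ≤ K) (hh : 1 ≤ h) : 2 ≤ soloBase K h := by
  have : 1 * 2 ≤ h * K := Nat.mul_le_mul hh hK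
  unfold soloBase
  omega

/-- The exponents of a set family are `< D^n`. -/
theorem soloExp_lt {K h m n : ℕ} (hK : 2 ≤ K) (hh : 1 ≤ h) (S : Fin m → Finset (Fin n))
    (i : Fin m) : soloExp K h S i < soloBase K h ^ n := by
  classical
  unfold soloExp
  have hmap : (∑ r ∈ S i, soloBase K h ^ (r : ℕ))
      = ∑ t ∈ (S i).map Fin.valEmbedding, soloBase K h ^ t := by
    rw [Finset.sum_map]
    rfl
  rw [hmap]
  exact Nat.geomSum_lt (solo_two_le_base hK hh) fun t ht => by
    obtain ⟨r, -, rfl⟩ := Finset.mem_map.1 ht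
    exact r.isLt

/-! ### The cyclic bound structure and the reduction -/

/-- **A bound function for the cyclic-group problem, bundled with its defining property** (a
HYPOTHESIS wherever it occurs; Conjecture (Q_cyc) of the note asserts one exists with
`Q s = O(s^γ)`, `γ < 3/2`).  `bound`: for every modulus `d ≥ 1`, every `s` functions
`v : ℤ/d → ℂˢ` and every `E ⊂ [0, d)` that is `(K, h)`-FREE MODULO `d` — every integer combination
`∑_{e ∈ E} c_e e` with at most `K` nonzero `c_e`, all `|c_e| ≤ h`, that is divisible by `d` has all
`c_e = 0` — such that each character `a ↦ ζ_d^{e a}` (`e ∈ E`) agrees on all of `ℤ/d` with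
`a ↦ Γ_e(v(a))` for some `Γ_e` of total degree `≤ 2`, one has `|E| ≤ Q s`. -/
structure SoloCycQuadSpanBound (K h : ℕ) where
  /-- the bound, as a function of the number `s` of functions on `ℤ/d` -/
  Q : ℕ → ℕ
  /-- free character families of `ℤ/d` realised inside a quadratic span of `s` functions have at
  most `Q s` members, uniformly in `d` -/
  bound : ∀ (d s : ℕ), 0 < d → ∀ (v : Fin d → Fin s → ℂ) (E : Finset ℕ), (∀ e ∈ E, e < d) →
    (∀ c : ℕ → ℤ, (E.filter fun e => c e ≠ 0).card ≤ K → (∀ e, |c e| ≤ h) →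
        ((d : ℤ) ∣ ∑ e ∈ E, c e * (e : ℤ)) → ∀ e ∈ E, c e = 0) →
    (∀ e ∈ E, ∃ Γ : MvPolynomial (Fin s) ℂ, Γ.totalDegree ≤ 2 ∧
        ∀ a : Fin d, eval (v a) Γ = soloCycChar d e a) →
      E.card ≤ Q s

/-- **Freeness modulo a large modulus.** For a `(K, h)`-design and `d > K h D^n`, an integer
combination of the exponents `e_i` with at most `K` nonzero coefficients of absolute value `≤ h`
that is divisible by `d` is trivial: it has absolute value `< d`, so it vanishes, and
`solo_free_image` applies. -/
theorem solo_free_image_mod {K h m n : ℕ} (hK : 2 ≤ K) (hh : 1 ≤ h) (S : SoloDesign K h m n)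
    {d : ℕ} (hd : K * h * soloBase K h ^ n < d) (c : ℕ → ℤ)
    (hc : ((univ.image (soloExp K h S.S)).filter fun e => c e ≠ 0).card ≤ K)
    (hc2 : ∀ e, |c e| ≤ h)
    (hdvd : (d : ℤ) ∣ ∑ e ∈ univ.image (soloExp K h S.S), c e * (e : ℤ)) :
    ∀ e ∈ univ.image (soloExp K h S.S), c e = 0 := by
  classical
  have hlt : ∀ e ∈ univ.image (soloExp K h S.S), e < soloBase K h ^ n := by
    intro e he
    obtain ⟨i, -, rfl⟩ := Finset.mem_image.1 he
    exact soloExp_lt hK hh S.S i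
  have habs : |∑ e ∈ univ.image (soloExp K h S.S), c e * (e : ℤ)| < d := by
    calc |∑ e ∈ univ.image (soloExp K h S.S), c e * (e : ℤ)|
        ≤ ∑ e ∈ univ.image (soloExp K h S.S), |c e * (e : ℤ)| := Finset.abs_sum_le_sum_abs _ _
      _ = ∑ e ∈ (univ.image (soloExp K h S.S)).filter (fun e => c e ≠ 0), |c e * (e : ℤ)| := by
          rw [Finset.sum_filter]
          refine Finset.sum_congr rfl fun e _ => ?_
          by_cases hce : c e = 0 <;> simp [hce]
      _ ≤ ∑ e ∈ (univ.image (soloExp K h S.S)).filter (fun e => c e ≠ 0),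
            (h : ℤ) * ((soloBase K h ^ n : ℕ) : ℤ) := by
          refine Finset.sum_le_sum fun e he => ?_
          have heE : e ∈ univ.image (soloExp K h S.S) := (Finset.mem_filter.1 he).1
          rw [abs_mul]
          have h1 : |c e| ≤ h := hc2 e
          have h2 : |(e : ℤ)| ≤ ((soloBase K h ^ n : ℕ) : ℤ) := by
            rw [abs_of_nonneg (by positivity)]
            exact_mod_cast (hlt e heE).le
          exact mul_le_mul h1 h2 (abs_nonneg _) (by positivity)
      _ = (((univ.image (soloExp K h S.S)).filter fun e => c e ≠ 0).card : ℤ)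
            * ((h : ℤ) * ((soloBase K h ^ n : ℕ) : ℤ)) := by
          rw [Finset.sum_const, nsmul_eq_mul]
      _ ≤ (K : ℤ) * ((h : ℤ) * ((soloBase K h ^ n : ℕ) : ℤ)) := by
          refine mul_le_mul_of_nonneg_right ?_ (by positivity)
          exact_mod_cast hc
      _ < d := by
          have h3 : ((K * h * soloBase K h ^ n : ℕ) : ℤ) < d := by exact_mod_cast hd
          push_cast at h3 ⊢
          linarith
  have hzero : (∑ e ∈ univ.image (soloExp K h S.S), c e * (e : ℤ)) = 0 :=
    Int.eq_zero_of_abs_lt_dvd hdvd habs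
  exact solo_free_image S hK hh c hc hc2 hzero

/-- **Cyclic quad-span bound ⇒ elusive design maps.** For a `(K, h)`-design `S` of `m` sets
(`K ≥ 2`, `h ≥ 1`) and a cyclic bound structure `B` with `B.Q s < m`, the monomial map of `S` is
`(s, 2)`-elusive over `ℂ` (Raz 2010, Def. 1.1): restrict a cover to the cyclic subgroup
`a ↦ (ζ_d^{a D^r})_r` of the torus with `d = K h D^n + 1`. [cite: Raz2010, Def. 1.1] -/
theorem soloInformed_isElusive_designMap_of_cyc {K h m n : ℕ} (hK : 2 ≤ K) (hh : 1 ≤ h)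
    (S : SoloDesign K h m n) (B : SoloCycQuadSpanBound K h) {s : ℕ} (hm : B.Q s < m) :
    IsElusive (soloDesignMap S.S) s 2 := by
  classical
  by_contra hne
  obtain ⟨d, hd, hdpos⟩ : ∃ d : ℕ, K * h * soloBase K h ^ n < d ∧ 0 < d :=
    ⟨K * h * soloBase K h ^ n + 1, Nat.lt_succ_self _, Nat.succ_pos _⟩
  obtain ⟨Γ, hΓ, v, hv⟩ := solo_restrict_of_not_isElusive hne (soloCycPoint K h d (n := n))
  have hcard : (univ.image (soloExp K h S.S)).card = m := by
    rw [Finset.card_image_of_injective _ (solo_exp_injective S hK hh), Finset.card_univ,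
      Fintype.card_fin]
  have hKh : 0 < K * h := Nat.mul_pos (by omega) (by omega)
  have hE : ∀ e ∈ univ.image (soloExp K h S.S), e < d := by
    intro e he
    obtain ⟨i, -, rfl⟩ := Finset.mem_image.1 he
    have h1 := soloExp_lt hK hh S.S i
    have h2 : soloBase K h ^ n ≤ K * h * soloBase K h ^ n :=
      Nat.le_mul_of_pos_left (soloBase K h ^ n) hKh
    exact h1.trans_le (h2.trans hd.le)
  have hspan : ∀ e ∈ univ.image (soloExp K h S.S), ∃ Γ' : MvPolynomial (Fin s) ℂ,
      Γ'.totalDegree ≤ 2 ∧ ∀ a : Fin d, eval (v a) Γ' = soloCycChar d e a := by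
    intro e he
    obtain ⟨i, -, rfl⟩ := Finset.mem_image.1 he
    exact ⟨Γ i, hΓ i, fun a => by rw [hv a i, solo_eval_designMap_cyc]⟩
  have := B.bound d s hdpos v _ hE (solo_free_image_mod hK hh S hd) hspan
  omega

/-- **Cyclic bound + explicit designs ⇒ `VP ℂ ≠ VNP ℂ`** through Raz 2010, §1 result 1 (tree
theorem `Raz2010_result_1_holds`): `(K, h)`-designs `S n` of `m n = n^{ω(1)}` subsets of `Fin n`,
`m n ^ 9 ≤ s n ^ 10` and `B.Q (s n) < m n` eventually, and poly(`n`)-definability of the design map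
(hypothesis `hdef`). [cite: Raz2010, §1 result 1, Defs. 1.1, 1.3] -/
theorem soloInformed_vp_ne_vnp_of_cycQuadSpanBound {K h : ℕ} (hK : 2 ≤ K) (hh : 1 ≤ h)
    (B : SoloCycQuadSpanBound K h) {m s : ℕ → ℕ} (S : ∀ n, SoloDesign K h (m n) n)
    (hm : ∀ c : ℕ, ∃ n₀ : ℕ, ∀ n ≥ n₀, n ^ c ≤ m n)
    (hs : ∃ n₀ : ℕ, ∀ n ≥ n₀, m n ^ 9 ≤ s n ^ 10)
    (hQm : ∃ n₀ : ℕ, ∀ n ≥ n₀, B.Q (s n) < m n)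
    (hdef : IsPolyDefinableMap (m := m) (σ := fun n => Fin n) fun n => soloDesignMap (S n).S) :
    VP ℂ ≠ VNP ℂ := by
  refine perNotPComputableComplex_iff_holds.mp ?_
  have hdeg : IsPBounded
      (fun n => Finset.univ.sup fun i : Fin (m n) => (soloDesignMap (S n).S i).totalDegree) :=
    IsPBounded.id.mono fun n => Finset.sup_le fun i _ => solo_totalDegree_designMap_le (S n).S i
  have hel : ∃ n₀ : ℕ, ∀ n ≥ n₀, IsElusive (soloDesignMap (S n).S) (s n) 2 := by
    obtain ⟨n₀, h0⟩ := hQm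
    exact ⟨n₀, fun n hn => soloInformed_isElusive_designMap_of_cyc hK hh (S n) B (h0 n hn)⟩
  exact Raz2010_result_1_holds ℂ ringChar_complex_ne_two m s (fun n => soloDesignMap (S n).S)
    hm hs hdef hdeg hel

/-- **The same reduction through Raz 2010, Cor. 5.8 (= Cor. 1.14), with `r = r(n)` free** — the
form in which the cyclic bound is needed only with SOME exponent `γ < 3/2`.
[cite: Raz2010, Cor. 5.8 = Cor. 1.14, Defs. 1.1, 1.3] -/
theorem soloInformed_vp_ne_vnp_of_cycQuadSpanBound_cor58 {K h : ℕ} (hK : 2 ≤ K) (hh : 1 ≤ h)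
    (B : SoloCycQuadSpanBound K h)
    {r s : ℕ → ℕ} (S : ∀ n, SoloDesign K h (Nat.choose (n + r n - 1) (r n)) n)
    (hpar : ∃ n₀ : ℕ, ∀ n ≥ n₀, 3 ≤ r n ∧ r n ≤ n ∧ n ≤ s n)
    (hgrow : ∀ c : ℕ, ∃ n₀ : ℕ, ∀ n ≥ n₀,
      n ^ c * Nat.choose (n + 2 * r n / 3 - 1) (2 * r n / 3) ≤ s n)
    (hQm : ∃ n₀ : ℕ, ∀ n ≥ n₀, B.Q (s n) < Nat.choose (n + r n - 1) (r n))
    (hdef : IsPolyDefinableMap (m := fun n => Nat.choose (n + r n - 1) (r n))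
      (σ := fun n => Fin n) fun n => soloDesignMap (S n).S) :
    VP ℂ ≠ VNP ℂ := by
  refine perNotPComputableComplex_iff_holds.mp ?_
  have hel : ∃ n₀ : ℕ, ∀ n ≥ n₀, ∃ (G : Type) (_ : Field G) (_ : Algebra ℂ G),
      IsElusive (fun i => MvPolynomial.map (algebraMap ℂ G) (soloDesignMap (S n).S i))
        (s n) 2 := by
    obtain ⟨n₀, h0⟩ := hQm
    refine ⟨n₀, fun n hn => ⟨ℂ, inferInstance, inferInstance, ?_⟩⟩
    have hid : (fun i => MvPolynomial.map (algebraMap ℂ ℂ) (soloDesignMap (S n).S i))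
        = soloDesignMap (S n).S := by
      funext i
      rw [Algebra.algebraMap_self, MvPolynomial.map_id]
    rw [hid]
    exact soloInformed_isElusive_designMap_of_cyc hK hh (S n) B (h0 n hn)
  exact Raz2010_cor_5_8_holds ℂ ringChar_complex_ne_two r s (fun n => soloDesignMap (S n).S)
    hpar hgrow hdef hel

/-- **Summit form.** The cyclic bound (with the Cor. 5.8 parameters and designs) yields the tree's
summit statement `ValiantsHypothesis` (`= VP ℂ ≠ VNP ℂ`). -/
theorem soloInformed_valiantsHypothesis_of_cycQuadSpanBound_cor58 {K h : ℕ} (hK : 2 ≤ K)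
    (hh : 1 ≤ h) (B : SoloCycQuadSpanBound K h)
    {r s : ℕ → ℕ} (S : ∀ n, SoloDesign K h (Nat.choose (n + r n - 1) (r n)) n)
    (hpar : ∃ n₀ : ℕ, ∀ n ≥ n₀, 3 ≤ r n ∧ r n ≤ n ∧ n ≤ s n)
    (hgrow : ∀ c : ℕ, ∃ n₀ : ℕ, ∀ n ≥ n₀,
      n ^ c * Nat.choose (n + 2 * r n / 3 - 1) (2 * r n / 3) ≤ s n)
    (hQm : ∃ n₀ : ℕ, ∀ n ≥ n₀, B.Q (s n) < Nat.choose (n + r n - 1) (r n))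
    (hdef : IsPolyDefinableMap (m := fun n => Nat.choose (n + r n - 1) (r n))
      (σ := fun n => Fin n) fun n => soloDesignMap (S n).S) :
    ValiantsHypothesis :=
  soloInformed_vp_ne_vnp_of_cycQuadSpanBound_cor58 hK hh B S hpar hgrow hQm hdef

/-! ### Non-vacuity: characters with distinct frequencies are linearly independent -/

/-- Distinct frequencies `e, e' < d` give distinct roots `ζ_d^e ≠ ζ_d^{e'}`. -/
theorem soloZeta_pow_inj {d : ℕ} (hd : 0 < d) {e e' : ℕ} (he : e < d) (he' : e' < d)
    (H : soloZeta d ^ e = soloZeta d ^ e') : e = e' :=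
  (soloZeta_isPrimitiveRoot hd.ne').pow_inj he he' H

/-- **Characters with pairwise distinct frequencies in `[0, d)` are linearly independent** as
functions on `ℤ/d` (Vandermonde at the distinct nodes `ζ_d^e`). [folklore] -/
theorem solo_linearIndependent_cycChar {d : ℕ} (hd : 0 < d) (E : Finset ℕ)
    (hE : ∀ e ∈ E, e < d) : LinearIndependent ℂ (fun e : E => soloCycChar d e) := by
  classical
  rw [Fintype.linearIndependent_iff]
  intro g hg e₀
  have hNd : E.card ≤ d := by
    calc E.card ≤ (Finset.range d).card :=
          Finset.card_le_card fun e he => Finset.mem_range.2 (hE e he)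
      _ = d := Finset.card_range d
  let σ : Fin E.card ≃ E := (E.equivFin).symm
  let x : Fin E.card → ℂ := fun i => soloZeta d ^ ((σ i : ℕ))
  have hx : Function.Injective x := by
    intro i j hij
    have h1 := soloZeta_pow_inj hd (hE _ (σ i).2) (hE _ (σ j).2) hij
    exact σ.injective (Subtype.ext h1)
  let lam : Fin E.card → ℂ := fun i => g (σ i)
  have hvec : Matrix.vecMul lam (Matrix.vandermonde x) = 0 := by
    funext j
    have hj : (j : ℕ) < d := lt_of_lt_of_le j.isLt hNd
    have h0 := congr_fun hg ⟨j, hj⟩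
    simp only [Finset.sum_apply, Pi.smul_apply, smul_eq_mul, Pi.zero_apply, soloCycChar] at h0
    simp only [Matrix.vecMul, dotProduct, Matrix.vandermonde_apply, Pi.zero_apply]
    rw [← h0]
    refine Fintype.sum_equiv σ _ _ fun i => ?_
    simp only [lam, x, ← pow_mul]
  have hdet : (Matrix.vandermonde x).det ≠ 0 := Matrix.det_vandermonde_ne_zero_iff.2 hx
  have hlam : lam = 0 := Matrix.eq_zero_of_vecMul_eq_zero hdet hvec
  have h2 := congr_fun hlam (σ.symm e₀)
  simpa [lam] using h2

/-- **The trivial bound.** If the characters with frequencies in `E ⊂ [0, d)` lie in the quadratic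
span of `s` functions on `ℤ/d`, then `|E| ≤ dim_ℂ ℂ[y_1, …, y_s]_{≤ 2}`: the characters are
linearly independent and lie in the image of `Γ ↦ (a ↦ Γ(v(a)))` restricted to total degree
`≤ 2`. -/
theorem solo_card_le_finrank_of_cycQuadSpan {d s : ℕ} (hd : 0 < d) (v : Fin d → Fin s → ℂ)
    (E : Finset ℕ) (hE : ∀ e ∈ E, e < d)
    (hΓ : ∀ e ∈ E, ∃ Γ : MvPolynomial (Fin s) ℂ, Γ.totalDegree ≤ 2 ∧
      ∀ a : Fin d, eval (v a) Γ = soloCycChar d e a) :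
    E.card ≤ Module.finrank ℂ (restrictTotalDegree (Fin s) ℂ 2) := by
  classical
  have hΓ' : ∀ e : E, ∃ Γ : MvPolynomial (Fin s) ℂ, Γ.totalDegree ≤ 2 ∧
      ∀ a : Fin d, eval (v a) Γ = soloCycChar d e a := fun e => hΓ e e.2
  choose Γ hdeg hev using hΓ'
  let ev : MvPolynomial (Fin s) ℂ →ₗ[ℂ] (Fin d → ℂ) :=
    LinearMap.pi fun a => (MvPolynomial.aeval (v a)).toLinearMap
  let f := ev.domRestrict (restrictTotalDegree (Fin s) ℂ 2)
  have hmem : ∀ e : E, Γ e ∈ restrictTotalDegree (Fin s) ℂ 2 := fun e =>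
    (mem_restrictTotalDegree _ _ _).2 (hdeg e)
  have hfi : ∀ e : E, f ⟨Γ e, hmem e⟩ = soloCycChar d e := by
    intro e; funext a
    simp [f, ev, hev e a]
  let q : E → LinearMap.range f := fun e => ⟨soloCycChar d e, ⟨Γ e, hmem e⟩, hfi e⟩
  have hq : LinearIndependent ℂ q := by
    apply LinearIndependent.of_comp (LinearMap.range f).subtype
    exact solo_linearIndependent_cycChar hd E hE
  calc E.card = Fintype.card E := (Fintype.card_coe E).symm
    _ ≤ Module.finrank ℂ (LinearMap.range f) := hq.fintype_card_le_finrank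
    _ ≤ Module.finrank ℂ (restrictTotalDegree (Fin s) ℂ 2) := LinearMap.finrank_range_le f

/-- **Non-vacuity of `SoloCycQuadSpanBound`.** The structure is inhabited with the trivial bound
`Q s = C(s+2, 2)` (`≥ dim_ℂ ℂ[y_1, …, y_s]_{≤ 2}`, `solo_finrank_restrictTotalDegree_two_le`).  The
summit-relevant Conjecture (Q_cyc) asks for `Q s = O(s^γ)` with `γ < 3/2`; character ("sumset")
sections force `γ ≥ 1 + 1/⌊K/2⌋`. -/
def soloInformed_cycQuadSpanBound_trivial (K h : ℕ) : SoloCycQuadSpanBound K h where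
  Q s := Nat.choose (s + 2) 2
  bound _ s hd v E hE _ hΓ :=
    (solo_card_le_finrank_of_cycQuadSpan hd v E hE hΓ).trans
      (solo_finrank_restrictTotalDegree_two_le s)

/-- `SoloCycQuadSpanBound K h` is inhabited (for every `K, h`). -/
theorem soloInformed_nonempty_cycQuadSpanBound (K h : ℕ) : Nonempty (SoloCycQuadSpanBound K h) :=
  ⟨soloInformed_cycQuadSpanBound_trivial K h⟩

end Summit.ValiantsHypothesis.ValiantsHypothesis.Theorems

end
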